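import Summits.BirchSwinnertonDyer.BirchSwinnertonDyer.Theorems.GenusKolyvaginAtTwoTorsionCellD0BasePositiveResidues
import HarnessLib

/-!
# D0≤2, one genus step: `#Sel⁽²⁾(E₀^{(−p₀q₁q₂)}/ℚ) ∈ {4, 8}` (parity-free half of the `C₁` law at `#Q₀ = 2`)

Crux R″ `RankOneTwoTorsionResidualAtTwo` (stmt-27478), LINE 49 «full_vertex», stub D0≤2
`FullTorsionGenusSelmerLawUpToTwoAtTwo`, slice `#Q₀ = 2`, the rank-one genus twist `C₁ = E₀^{(−p₀M₀)}`, `M₀ = q₁q₂`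
(setting of `…D0TripleTwistKernel`: `E/ℚ` with rational `2`-torsion `e₁ < e₂ < e₃`, rank `0`, `Ш(E)[2] = 0`, good
reduction off `S ∋ 2`; distinct primes `p, q₁, q₂ ∉ S`, `p ≡ 7 (mod 8)`, `qᵢ ≡ 3 (mod 4)`, `q₁q₂ ≡ 1 (mod 8)`,
`(−p/ℓ) = (q₁q₂/ℓ) = 1` for odd `ℓ ∈ S`; `δ₁, δ₂` non-residues at `q₁` and at `q₂` ("full-admissible"); and the
reciprocity transport `qr_{q₁}(e₂ − e₁) = qr_{q₂}(e₂ − e₁)` of the `S`-unit `e₂ − e₁`).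

* **`parityBits_of_mem_selmerGroup_twist_triple`** — the parity vector at `(q₁, q₂)` of a `p`-unramified class of
  `Sel⁽²⁾(E^{(−pq₁q₂)})` is `0` or ONE explicit vector `π₀(t, w₁, w₂)`: the `I₀*` relations at `p, q₁, q₂`, the sign
  relation at `∞`, (R1)/(R2), and — for aligned classes — the structure of `Sel⁽²⁾(E)`, leave a `1`-dimensional
  solution space (a finite check in `ℤ/2`, `parityBits_solve`).
* **`natCard_selmerGroup_twist_triple_eq_four_or_eight`** — hence `1 ≤ #N_p ≤ 2` (the parity map is injective on
  `N_p` by `eq_zero_of_mem_selmerGroup_twist_triple`) and `#Sel⁽²⁾(E^{(−pq₁q₂)}/ℚ) = 4·#N_p ∈ {4, 8}`, in particular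
  `≤ 8`. Equality `= 8` is parity-free when `(q₁q₂/p) = 1` and rests on `2`-parity when `(q₁q₂/p) = −1` (LEAD memo
  `D0le2_memo.md` §2(b)); not in this file.

Everything is proved; no LINE 49 statement is restated; BSD is not advanced by this file alone.

## References

* [SilvermanAEC2009] J. H. Silverman, *The Arithmetic of Elliptic Curves*, 2nd ed., GTM 106, Prop. X.1.4, X.4.9.
* [Kramer1981] K. Kramer, *Arithmetic of elliptic curves upon quadratic extension*, Trans. AMS 264 (1981), Thm. 1.
* [MazurRubin2010] B. Mazur, K. Rubin, Invent. Math. 181 (2010), Lemma 2.10, Lemma 2.11.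
-/

noncomputable section

set_option synthInstance.maxSize 2048 in
/-- The `ℤ/2`-elimination behind `#N_p ≤ 2`: the `I₀*` relations at `p` (P), at `q₁, q₂` (Q), and the aligned-class
constraint (C) force the parity vector `(α₁, β₁, α₂, β₂)` to be `0` or `(1 + w₂(1+t), 1 + tw₂, 1 + w₁(1+t), 1 + tw₁)`.
[folklore] -/
private theorem Summit.BirchSwinnertonDyer.BirchSwinnertonDyer.Theorems.GenusKolyvaginAtTwo.TorsionCellD0.parityBits_solve (t u w₁ w₂ α₁ β₁ α₂ β₂ A B s : ZMod 2)
    (P1 : s + α₁ * w₁ + α₂ * w₂ = 0) (P2 : s + β₁ * w₁ + β₂ * w₂ = 0)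
    (Q1a : A + α₂ * u = α₁ * (w₁ + u + t) + β₁ * 1) (Q1b : B + β₂ * u = α₁ * 1 + β₁ * (w₁ + u + (t + 1)))
    (Q2a : A + α₁ * (u + 1) = α₂ * (w₂ + u + 1 + t) + β₂ * 1)
    (Q2b : B + β₁ * (u + 1) = α₂ * 1 + β₂ * (w₂ + u + 1 + (t + 1)))
    (C : α₁ = α₂ → β₁ = β₂ → s = 0 → (A = 0 ∧ B = 0) ∨ (A = t + 1 ∧ B = t)) :
    (α₁ = 0 ∧ β₁ = 0 ∧ α₂ = 0 ∧ β₂ = 0) ∨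
      (α₁ = 1 + w₂ * (1 + t) ∧ β₁ = 1 + t * w₂ ∧ α₂ = 1 + w₁ * (1 + t) ∧ β₂ = 1 + t * w₁) := by
  revert t u w₁ w₂ α₁ β₁ α₂ β₂ A B s; decide

open scoped Classical

namespace Summit.BirchSwinnertonDyer.BirchSwinnertonDyer.Theorems.GenusKolyvaginAtTwo.TorsionCellD0

open WeierstrassCurve WeierstrassCurve.Affine WeierstrassCurve.Affine.Point
open Literature.NumberTheory.GaloisRepresentations Literature.NumberTheory.EllipticCurves Field
open Literature.NumberTheory.EllipticCurves.TwoDescentLocal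
open Literature.NumberTheory.EllipticCurves.KramerTwoDescent
open IsDedekindDomain NumberField Rat.HeightOneSpectrum

variable (E : WeierstrassCurve ℚ) [E.IsElliptic] {e₁ e₂ e₃ : ℚ}
variable (S : Finset ℕ) {p q₁ q₂ : ℕ} [hp : Fact p.Prime] [hq₁ : Fact q₁.Prime] [hq₂ : Fact q₂.Prime]

/-! ## The parity vector of a `p`-unramified Selmer class of `E^{(−pq₁q₂)}` -/

section Parities


/-- **The parity vector at `(q₁, q₂)` of a `p`-unramified Selmer class of `E^{(−pq₁q₂)}`** (setting of the module
docstring). If `c ∈ Sel⁽²⁾(E^{(d)}/ℚ)`, `d = −pq₁q₂`, has components `([a],[b])` with `v_p(a), v_p(b)` even, then with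
`αᵢ = v_{qᵢ}(a)`, `βᵢ = v_{qᵢ}(b) (mod 2)`, `t = qr_{q₁}(e₂−e₁)`, `wᵢ = qr_p(qᵢ)`: either `α₁ = β₁ = α₂ = β₂ = 0`, or
`(α₁, β₁, α₂, β₂) = (1 + w₂(1+t), 1 + tw₂, 1 + w₁(1+t), 1 + tw₁)`.
[cite: SilvermanAEC2009, Prop. X.1.4, Prop. X.4.9] [cite: Kramer1981, Thm. 1] [cite: MazurRubin2010, Lemma 2.10, Lemma 2.11] -/
theorem parityBits_of_mem_selmerGroup_twist_triple (h : E.toAffine.SplitTwoTorsion e₁ e₂ e₃) (hS : ∀ q ∈ S, q.Prime)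
    (h2S : 2 ∈ S) (h12 : e₁ < e₂) (h23 : e₂ < e₃)
    (hgood : ∀ ℓ : ℕ, (hℓ : ℓ.Prime) → ℓ ∉ S → haveI : Fact ℓ.Prime := ⟨hℓ⟩;
      padicValRat ℓ (e₁ - e₂) = 0 ∧ padicValRat ℓ (e₁ - e₃) = 0 ∧ padicValRat ℓ (e₂ - e₃) = 0)
    (hN : ∀ ℓ : ℕ, ℓ.Prime → ℓ ∉ S → ¬ ℓ ∣ E.conductorNorm ℤ)
    (hrank : E.mordellWeilRank = 0) (hsha : ∀ x ∈ E.sha, (2 : ℕ) • x = 0 → x = 0)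
    (hpS : p ∉ S) (hq₁S : q₁ ∉ S) (hq₂S : q₂ ∉ S) (hpq₁ : p ≠ q₁) (hpq₂ : p ≠ q₂) (hne : q₁ ≠ q₂)
    (hp8 : p % 8 = 7) (hq₁4 : q₁ % 4 = 3) (hq₂4 : q₂ % 4 = 3) (hM8 : ((q₁ : ℤ) * q₂) % 8 = 1)
    (hsplitp : ∀ ℓ ∈ S, (hℓ : ℓ.Prime) → ℓ ≠ 2 → haveI : Fact ℓ.Prime := ⟨hℓ⟩; legendreSym ℓ (-(p : ℤ)) = 1)
    (hsplitM : ∀ ℓ ∈ S, (hℓ : ℓ.Prime) → ℓ ≠ 2 → haveI : Fact ℓ.Prime := ⟨hℓ⟩; legendreSym ℓ ((q₁ : ℤ) * q₂) = 1)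
    (hδ₁₁ : qrBit q₁ ((e₁ - e₂) * (e₁ - e₃)) = 1) (hδ₂₁ : qrBit q₁ ((e₂ - e₁) * (e₂ - e₃)) = 1)
    (hδ₁₂ : qrBit q₂ ((e₁ - e₂) * (e₁ - e₃)) = 1) (hδ₂₂ : qrBit q₂ ((e₂ - e₁) * (e₂ - e₃)) = 1)
    (ht : qrBit q₂ (e₂ - e₁) = qrBit q₁ (e₂ - e₁))
    {d : ℚ} (hd : d = -(p : ℚ) * ((q₁ : ℚ) * q₂)) [(E.quadraticTwist d).IsElliptic]
    {c : galH1Torsion (E.quadraticTwist d) 2} (hc : c ∈ selmerGroup (E.quadraticTwist d) 2) (a b : ℚˣ)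
    (ha : kummerEquiv ℚ 2 ((E.quadraticTwist d).twoTorsionCharH1 (h.quadraticTwist d) c) =
      Additive.ofMul (QuotientGroup.mk a))
    (hb : kummerEquiv ℚ 2 ((E.quadraticTwist d).twoTorsionCharH1 (h.quadraticTwist d).swap₁₂ c) =
      Additive.ofMul (QuotientGroup.mk b))
    (hpa : parityBit p (a : ℚ) = 0) (hpb : parityBit p (b : ℚ) = 0) :
    (parityBit q₁ (a : ℚ) = 0 ∧ parityBit q₁ (b : ℚ) = 0 ∧ parityBit q₂ (a : ℚ) = 0 ∧ parityBit q₂ (b : ℚ) = 0) ∨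
      (parityBit q₁ (a : ℚ) = 1 + qrBit p (q₂ : ℚ) * (1 + qrBit q₁ (e₂ - e₁)) ∧
        parityBit q₁ (b : ℚ) = 1 + qrBit q₁ (e₂ - e₁) * qrBit p (q₂ : ℚ) ∧
        parityBit q₂ (a : ℚ) = 1 + qrBit p (q₁ : ℚ) * (1 + qrBit q₁ (e₂ - e₁)) ∧
        parityBit q₂ (b : ℚ) = 1 + qrBit q₁ (e₂ - e₁) * qrBit p (q₁ : ℚ)) := by
  -- the two kernels
  obtain ⟨ma, hma0, hmadiv, hmapos, ⟨hga, hmka⟩, -, hR2a, hQ₁a, hQ₂a, hPa⟩ :=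
    exists_intKernel_of_mem_selmerGroup_twist_triple E S h hS (fun ℓ hℓ hℓS => ⟨(hgood ℓ hℓ hℓS).1, (hgood ℓ hℓ hℓS).2.1⟩)
      hpS hq₁S hq₂S hpq₁ hpq₂ hne hp8 hq₁4 hq₂4 hM8 hsplitp hsplitM hd hc a ha hpa
  obtain ⟨mb, hmb0, hmbdiv, hmbpos, ⟨hgb, hmkb⟩, -, hR2b, hQ₁b, hQ₂b, hPb⟩ :=
    exists_intKernel_of_mem_selmerGroup_twist_triple E S h.swap₁₂ hS
      (fun ℓ hℓ hℓS => ⟨by rw [← neg_sub, padicValRat.neg]; exact (hgood ℓ hℓ hℓS).1, (hgood ℓ hℓ hℓS).2.2⟩)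
      hpS hq₁S hq₂S hpq₁ hpq₂ hne hp8 hq₁4 hq₂4 hM8 hsplitp hsplitM hd hc b hb hpb
  subst hd
  have h' := h.quadraticTwist (-(p : ℚ) * ((q₁ : ℚ) * q₂))
  have hp0 : (0 : ℚ) < p := by exact_mod_cast hp.out.pos
  have hq₁0 : (0 : ℚ) < q₁ := by exact_mod_cast hq₁.out.pos
  have hq₂0 : (0 : ℚ) < q₂ := by exact_mod_cast hq₂.out.pos
  have hdneg : -(p : ℚ) * ((q₁ : ℚ) * q₂) < 0 := by nlinarith [mul_pos hq₁0 hq₂0]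
  have he21 : e₂ - e₁ ≠ 0 := sub_ne_zero.mpr h.ne₁₂.symm
  obtain ⟨g12p, g13p, g23p⟩ := hgood p hp.out hpS
  obtain ⟨g12₁, g13₁, g23₁⟩ := hgood q₁ hq₁.out hq₁S
  obtain ⟨g12₂, g13₂, g23₂⟩ := hgood q₂ hq₂.out hq₂S
  have hm1₁ := qrBit_neg_one_eq_one_of_emod_four hq₁4
  have hm1₂ := qrBit_neg_one_eq_one_of_emod_four hq₂4
  have ht₁' : qrBit q₁ (e₁ - e₂) = qrBit q₁ (e₂ - e₁) + 1 := by
    rw [show e₁ - e₂ = (-1) * (e₂ - e₁) by ring, qrBit_mul q₁ (by norm_num) he21, hm1₁, add_comm]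
  have ht₂' : qrBit q₂ (e₁ - e₂) = qrBit q₁ (e₂ - e₁) + 1 := by
    rw [show e₁ - e₂ = (-1) * (e₂ - e₁) by ring, qrBit_mul q₂ (by norm_num) he21, hm1₂, ht, add_comm]
  -- (P) the `p`-residues vanish
  obtain ⟨hqa, hqb⟩ := E.qrBit_eq_zero_quadraticTwist_of_parityBit_eq_zero h (q := p)
    (padicValRat_negTriple_p hpq₁ hpq₂) g12p g13p g23p hc a b ha hb hpa hpb
  -- (∞) the two components have the same sign
  have hab : 0 < (a : ℚ) * b :=
    (E.quadraticTwist (-(p : ℚ) * ((q₁ : ℚ) * q₂))).mul_pos_of_mem_selmerGroup_of_gt h'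
      (mul_lt_mul_of_neg_left h12 hdneg) (mul_lt_mul_of_neg_left h23 hdneg) hc a b ha hb
  have hs : qrBit p (mb : ℚ) = qrBit p (ma : ℚ) := by
    rw [hR2a, hR2b]
    by_cases hap : 0 < (a : ℚ)
    · rw [if_pos hap, if_pos (pos_of_mul_pos_right hab hap.le)]
    · have hbn : ¬ 0 < (b : ℚ) := fun hbp => hap (pos_of_mul_pos_left hab hbp.le)
      rw [if_neg hap, if_neg hbn]
  -- (Q) the `I₀*` relations at `q₁` and `q₂`
  obtain ⟨R1₁, R2₁⟩ := E.qrBit_rel_quadraticTwist_of_mem_selmerGroup h (q := q₁) (padicValRat_negTriple_q₁ hpq₁ hne)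
    g12₁ g13₁ g23₁ hc a b ha hb
  obtain ⟨R1₂, R2₂⟩ := E.qrBit_rel_quadraticTwist_of_mem_selmerGroup h (q := q₂) (padicValRat_negTriple_q₂ hpq₂ hne)
    g12₂ g13₂ g23₂ hc a b ha hb
  rw [hQ₁a, qrBit_negTriple_q₁ hpq₁ hp8 hq₁4, hδ₁₁] at R1₁
  rw [hQ₁b, qrBit_negTriple_q₁ hpq₁ hp8 hq₁4, hδ₂₁, ht₁'] at R2₁
  rw [hQ₂a, qrBit_negTriple_q₂ hpq₂ hne hp8 hq₁4 hq₂4, hδ₁₂, ht] at R1₂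
  rw [hQ₂b, qrBit_negTriple_q₂ hpq₂ hne hp8 hq₁4 hq₂4, hδ₂₂, ht₂'] at R2₂
  rw [hqa] at hPa
  rw [hqb, hs] at hPb
  -- (C) aligned classes: the class `c_E(ma, mb)` is Selmer with `mb > 0`
  have hC : parityBit q₁ (a : ℚ) = parityBit q₂ (a : ℚ) → parityBit q₁ (b : ℚ) = parityBit q₂ (b : ℚ) →
      qrBit p (ma : ℚ) = 0 →
      (qrBit q₁ (ma : ℚ) = 0 ∧ qrBit q₁ (mb : ℚ) = 0) ∨
        (qrBit q₁ (ma : ℚ) = qrBit q₁ (e₂ - e₁) + 1 ∧ qrBit q₁ (mb : ℚ) = qrBit q₁ (e₂ - e₁)) := by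
    intro hαα hββ hs0
    have hapos : 0 < (a : ℚ) := by
      by_contra hna; rw [hR2a, if_neg hna] at hs0; exact one_ne_zero hs0
    have hbpos : 0 < (b : ℚ) := pos_of_mul_pos_right hab hapos.le
    have hmap : 0 < (ma : ℚ) := hmapos.mpr hapos
    have hmbp : 0 < (mb : ℚ) := hmbpos.mpr hbpos
    refine qrBit_pair_of_mem_selmerGroup_of_pos E h h12 h23 hrank hsha hm1₁ hδ₁₁ hδ₂₁ ?_ (Units.mk0 _ hma0) (Units.mk0 _ hmb0)
      (E.kummerEquiv_twoTorsionCharH1_twoDescentClass h _ _) (E.kummerEquiv_twoTorsionCharH1_swap_twoDescentClass h _ _)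
      (by rw [Units.val_mk0]; exact hmbp)
    -- the square parts `X = q₁^{α₁} q₂^{α₂}`, `Y` (products of `1` or `q₁q₂`: squares at the places of `S`)
    have hceq : c = (E.quadraticTwist (-(p : ℚ) * ((q₁ : ℚ) * q₂))).twoDescentClass h' a b :=
      (E.quadraticTwist (-(p : ℚ) * ((q₁ : ℚ) * q₂))).eq_twoDescentClass_of_kummerEquiv_eq h' a b ha hb
    have hXsq : ∀ (v : HeightOneSpectrum (𝓞 ℚ)), (primesEquiv v : ℕ) ∈ S → ∀ (x y : ZMod 2), x = y →
        IsSquare (algebraMap ℚ (v.adicCompletion ℚ)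
          ((if x = 1 then (q₁ : ℚ) else 1) * (if y = 1 then (q₂ : ℚ) else 1))) := by
      intro v hvS x y hxy
      subst hxy
      by_cases hx : x = 1
      · rw [if_pos hx, if_pos hx]
        by_cases hv2 : (primesEquiv v : ℕ) = 2
        · exact isSquare_mul_adicCompletion_two (q₁ := q₁) (q₂ := q₂) hq₁4 hq₂4 hM8 v hv2
        · haveI : Fact (primesEquiv v : ℕ).Prime := ⟨(primesEquiv v).2⟩
          exact isSquare_mul_adicCompletion_of_legendreSym (q₁ := q₁) (q₂ := q₂) v rfl hv2
            (fun h => hq₁S (h ▸ hvS)) (fun h => hq₂S (h ▸ hvS)) (hsplitM _ hvS (primesEquiv v).2 hv2)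
      · rw [if_neg hx, if_neg hx, mul_one, map_one]; exact ⟨1, (mul_one 1).symm⟩
    have hXa0 : (if parityBit q₁ (a : ℚ) = 1 then (q₁ : ℚ) else 1) * (if parityBit q₂ (a : ℚ) = 1 then (q₂ : ℚ) else 1) ≠ 0 :=
      mul_ne_zero (by split_ifs; exact hq₁0.ne'; exact one_ne_zero) (by split_ifs; exact hq₂0.ne'; exact one_ne_zero)
    have hXb0 : (if parityBit q₁ (b : ℚ) = 1 then (q₁ : ℚ) else 1) * (if parityBit q₂ (b : ℚ) = 1 then (q₂ : ℚ) else 1) ≠ 0 :=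
      mul_ne_zero (by split_ifs; exact hq₁0.ne'; exact one_ne_zero) (by split_ifs; exact hq₂0.ne'; exact one_ne_zero)
    -- `c_E(a, b) = c_E(ma, mb) + c_E(X, Y)`
    have hsplit : E.twoDescentClass h a b =
        E.twoDescentClass h (Units.mk0 _ hma0) (Units.mk0 _ hmb0) + E.twoDescentClass h (Units.mk0 _ hXa0) (Units.mk0 _ hXb0) := by
      rw [← twoDescentClass_mul]
      refine E.twoDescentClass_eq_of_mk_eq h (hmka.trans ?_) (hmkb.trans ?_)
      · congr 1; exact Units.ext (by rw [Units.val_mk0, Units.val_mul, Units.val_mk0, Units.val_mk0])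
      · congr 1; exact Units.ext (by rw [Units.val_mk0, Units.val_mul, Units.val_mk0, Units.val_mk0])
    rw [mem_selmerGroup_iff]
    refine ⟨fun v => ?_, fun w => ?_⟩
    · by_cases hvS : (primesEquiv v : ℕ) ∈ S
      · have hsq := isSquare_negTriple_adicCompletion S hpS hq₁S hq₂S hp8 hq₁4 hq₂4 hM8 hsplitp hsplitM v hvS
        have hloc : (E.quadraticTwist (-(p : ℚ) * ((q₁ : ℚ) * q₂))).twoDescentClass h' a b ∈
            selmerLocalKer (E.quadraticTwist (-(p : ℚ) * ((q₁ : ℚ) * q₂))) (v.adicCompletion ℚ) 2 := by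
          rw [← hceq]; exact ((mem_selmerGroup_iff _ _ _).mp hc).1 v
        have hE := (E.twoDescentClass_quadraticTwist_mem_selmerLocalKer_iff (v.adicCompletion ℚ)
          (charZero_of_injective_algebraMap (algebraMap ℚ _).injective) h hsq a b).mp hloc
        rw [hsplit] at hE
        have hXY : E.twoDescentClass h (Units.mk0 _ hXa0) (Units.mk0 _ hXb0) ∈ selmerLocalKer E (v.adicCompletion ℚ) 2 :=
          twoDescentClass_mem_selmerLocalKer_of_isSquare E h _ (charZero_of_injective_algebraMap (algebraMap ℚ _).injective)
            _ _ (by rw [Units.val_mk0]; exact hXsq v hvS _ _ hαα) (by rw [Units.val_mk0]; exact hXsq v hvS _ _ hββ)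
        have := sub_mem hE hXY
        rwa [add_sub_cancel_right] at this
      · have hℓ := (primesEquiv v).2
        have hℓ2 : (primesEquiv v : ℕ) ≠ 2 := fun h2 => hvS (h2 ▸ h2S)
        have hgoodv : E.HasGoodReductionAt v := by
          by_contra hbad; exact hN _ hℓ hvS ((E.dvd_conductorNorm_iff v).mpr hbad)
        exact E.twoDescentClass_mem_selmerLocalKer_of_mk_eq_intCast h v hℓ2 hgoodv _ _ ma mb hma0 hmb0 rfl rfl
          (hmadiv _ hℓ hvS) (hmbdiv _ hℓ hvS)
    · exact twoDescentClass_mem_selmerLocalKer_of_isSquare E h _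
        (charZero_of_injective_algebraMap (algebraMap ℚ _).injective) _ _
        (by rw [Units.val_mk0]; exact isSquare_algebraMap_completion_of_pos w hmap)
        (by rw [Units.val_mk0]; exact isSquare_algebraMap_completion_of_pos w hmbp)
  -- solve
  exact parityBits_solve (qrBit q₁ (e₂ - e₁)) (qrBit q₁ (q₂ : ℚ)) (qrBit p (q₁ : ℚ)) (qrBit p (q₂ : ℚ))
    (parityBit q₁ (a : ℚ)) (parityBit q₁ (b : ℚ)) (parityBit q₂ (a : ℚ)) (parityBit q₂ (b : ℚ))
    (qrBit q₁ (ma : ℚ)) (qrBit q₁ (mb : ℚ)) (qrBit p (ma : ℚ))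
    (by rw [← hPa]) (by rw [← hPb]) R1₁ R2₁ R1₂ R2₂ hC

end Parities

/-! ## The count: `#Sel⁽²⁾(E^{(−pq₁q₂)}) ∈ {4, 8}` -/

section Count

/-- **`#Sel⁽²⁾(E₀^{(−p₀q₁q₂)}/ℚ) ∈ {4, 8}`** — D0≤2 at `#Q₀ = 2` for the rank-one genus twist `C₁`, parity-free part
(setting of the module docstring): `#Sel⁽²⁾ = 4 · #N_p` with `1 ≤ #N_p ≤ 2`, the parity map `N_p → (ℤ/2)⁴` at
`(q₁, q₂)` being injective (`eq_zero_of_mem_selmerGroup_twist_triple`) with image in `{0, π₀}`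
(`parityBits_of_mem_selmerGroup_twist_triple`).
[cite: SilvermanAEC2009, Prop. X.1.4, Thm. X.4.2, Prop. X.4.9] [cite: Kramer1981, Thm. 1] -/
theorem natCard_selmerGroup_twist_triple_eq_four_or_eight (h : E.toAffine.SplitTwoTorsion e₁ e₂ e₃)
    (hS : ∀ q ∈ S, q.Prime) (h2S : 2 ∈ S) (h12 : e₁ < e₂) (h23 : e₂ < e₃)
    (hgood : ∀ ℓ : ℕ, (hℓ : ℓ.Prime) → ℓ ∉ S → haveI : Fact ℓ.Prime := ⟨hℓ⟩;
      padicValRat ℓ (e₁ - e₂) = 0 ∧ padicValRat ℓ (e₁ - e₃) = 0 ∧ padicValRat ℓ (e₂ - e₃) = 0)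
    (hN : ∀ ℓ : ℕ, ℓ.Prime → ℓ ∉ S → ¬ ℓ ∣ E.conductorNorm ℤ)
    (hrank : E.mordellWeilRank = 0) (hsha : ∀ x ∈ E.sha, (2 : ℕ) • x = 0 → x = 0)
    (hpS : p ∉ S) (hq₁S : q₁ ∉ S) (hq₂S : q₂ ∉ S) (hpq₁ : p ≠ q₁) (hpq₂ : p ≠ q₂) (hne : q₁ ≠ q₂)
    (hp8 : p % 8 = 7) (hq₁4 : q₁ % 4 = 3) (hq₂4 : q₂ % 4 = 3) (hM8 : ((q₁ : ℤ) * q₂) % 8 = 1)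
    (hsplitp : ∀ ℓ ∈ S, (hℓ : ℓ.Prime) → ℓ ≠ 2 → haveI : Fact ℓ.Prime := ⟨hℓ⟩; legendreSym ℓ (-(p : ℤ)) = 1)
    (hsplitM : ∀ ℓ ∈ S, (hℓ : ℓ.Prime) → ℓ ≠ 2 → haveI : Fact ℓ.Prime := ⟨hℓ⟩; legendreSym ℓ ((q₁ : ℤ) * q₂) = 1)
    (hδ₁₁ : qrBit q₁ ((e₁ - e₂) * (e₁ - e₃)) = 1) (hδ₂₁ : qrBit q₁ ((e₂ - e₁) * (e₂ - e₃)) = 1)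
    (hδ₁₂ : qrBit q₂ ((e₁ - e₂) * (e₁ - e₃)) = 1) (hδ₂₂ : qrBit q₂ ((e₂ - e₁) * (e₂ - e₃)) = 1)
    (ht : qrBit q₂ (e₂ - e₁) = qrBit q₁ (e₂ - e₁))
    {d : ℚ} (hd : d = -(p : ℚ) * ((q₁ : ℚ) * q₂)) [(E.quadraticTwist d).IsElliptic] :
    Nat.card (selmerGroup (E.quadraticTwist d) 2) = 4 ∨ Nat.card (selmerGroup (E.quadraticTwist d) 2) = 8 := by
  have h' := h.quadraticTwist d
  have hvd : padicValRat p d = 1 := by rw [hd]; exact padicValRat_negTriple_p hpq₁ hpq₂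
  rw [natCard_selmerGroup_quadraticTwist_eq_four_mul E h (q := p) hvd (hgood p hp.out hpS)]
  -- the bit vector at `(q₁, q₂)` of a class, through the parity characters
  let bits : galH1Torsion (E.quadraticTwist d) 2 → (ZMod 2 × ZMod 2) × (ZMod 2 × ZMod 2) := fun c =>
    ((parityHom q₁ (kummerEquiv ℚ 2 ((E.quadraticTwist d).twoTorsionCharH1 h' c)),
      parityHom q₁ (kummerEquiv ℚ 2 ((E.quadraticTwist d).twoTorsionCharH1 h'.swap₁₂ c))),
     (parityHom q₂ (kummerEquiv ℚ 2 ((E.quadraticTwist d).twoTorsionCharH1 h' c)),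
      parityHom q₂ (kummerEquiv ℚ 2 ((E.quadraticTwist d).twoTorsionCharH1 h'.swap₁₂ c))))
  have bits_sub : ∀ x y, bits (x - y) = bits x - bits y := fun x y => by
    simp only [bits, map_sub, Prod.mk_sub_mk]
  set π₀ : (ZMod 2 × ZMod 2) × (ZMod 2 × ZMod 2) :=
    ((1 + qrBit p (q₂ : ℚ) * (1 + qrBit q₁ (e₂ - e₁)), 1 + qrBit q₁ (e₂ - e₁) * qrBit p (q₂ : ℚ)),
     (1 + qrBit p (q₁ : ℚ) * (1 + qrBit q₁ (e₂ - e₁)), 1 + qrBit q₁ (e₂ - e₁) * qrBit p (q₁ : ℚ))) with hπ₀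
  -- on `N_p`: `bits ∈ {0, π₀}` and `bits` is injective
  have hval : ∀ c : galH1Torsion (E.quadraticTwist d) 2, c ∈ selmerGroup (E.quadraticTwist d) 2 →
      parityHom p (kummerEquiv ℚ 2 ((E.quadraticTwist d).twoTorsionCharH1 h' c)) = 0 →
      parityHom p (kummerEquiv ℚ 2 ((E.quadraticTwist d).twoTorsionCharH1 h'.swap₁₂ c)) = 0 →
      bits c = 0 ∨ bits c = π₀ := by
    intro c hc hpa hpb
    obtain ⟨a, b, ha, hb⟩ := (E.quadraticTwist d).exists_kummerEquiv_twoTorsionCharH1_pair_eq h' c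
    rw [(E.quadraticTwist d).parityHom_kummerEquiv_eq_parityBit h' p ha] at hpa
    rw [(E.quadraticTwist d).parityHom_kummerEquiv_eq_parityBit h'.swap₁₂ p hb] at hpb
    have key := parityBits_of_mem_selmerGroup_twist_triple E S h hS h2S h12 h23 hgood hN hrank hsha hpS hq₁S hq₂S hpq₁ hpq₂
      hne hp8 hq₁4 hq₂4 hM8 hsplitp hsplitM hδ₁₁ hδ₂₁ hδ₁₂ hδ₂₂ ht hd hc a b ha hb hpa hpb
    simp only [bits, (E.quadraticTwist d).parityHom_kummerEquiv_eq_parityBit h' _ ha,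
      (E.quadraticTwist d).parityHom_kummerEquiv_eq_parityBit h'.swap₁₂ _ hb]
    rcases key with ⟨h1, h2, h3, h4⟩ | ⟨h1, h2, h3, h4⟩
    · left; rw [h1, h2, h3, h4]; rfl
    · right; rw [h1, h2, h3, h4]
  have hinj : ∀ c : galH1Torsion (E.quadraticTwist d) 2, c ∈ selmerGroup (E.quadraticTwist d) 2 →
      parityHom p (kummerEquiv ℚ 2 ((E.quadraticTwist d).twoTorsionCharH1 h' c)) = 0 →
      parityHom p (kummerEquiv ℚ 2 ((E.quadraticTwist d).twoTorsionCharH1 h'.swap₁₂ c)) = 0 →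
      bits c = 0 → c = 0 := by
    intro c hc hpa hpb hb0
    obtain ⟨a, b, ha, hb⟩ := (E.quadraticTwist d).exists_kummerEquiv_twoTorsionCharH1_pair_eq h' c
    rw [(E.quadraticTwist d).parityHom_kummerEquiv_eq_parityBit h' p ha] at hpa
    rw [(E.quadraticTwist d).parityHom_kummerEquiv_eq_parityBit h'.swap₁₂ p hb] at hpb
    simp only [bits, (E.quadraticTwist d).parityHom_kummerEquiv_eq_parityBit h' _ ha,
      (E.quadraticTwist d).parityHom_kummerEquiv_eq_parityBit h'.swap₁₂ _ hb, Prod.ext_iff, Prod.fst_zero,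
      Prod.snd_zero] at hb0
    exact eq_zero_of_mem_selmerGroup_twist_triple E S h hS h2S hgood hN hrank hsha hpS hq₁S hq₂S hpq₁ hpq₂ hne hp8 hq₁4 hq₂4
      hM8 hsplitp hsplitM hδ₁₁ hδ₂₁ hd hc a b ha hb hpa hpb hb0.1.1 hb0.1.2 hb0.2.1 hb0.2.2
  -- so `N_p ↪ Bool`
  let g : {c : galH1Torsion (E.quadraticTwist d) 2 // c ∈ selmerGroup (E.quadraticTwist d) 2 ∧
      parityHom p (kummerEquiv ℚ 2 ((E.quadraticTwist d).twoTorsionCharH1 h' c)) = 0 ∧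
      parityHom p (kummerEquiv ℚ 2 ((E.quadraticTwist d).twoTorsionCharH1 h'.swap₁₂ c)) = 0} → Bool :=
    fun x => decide (bits x.1 = 0)
  have hg : Function.Injective g := by
    intro x y hxy
    have hbits : bits x.1 = bits y.1 := by
      simp only [g] at hxy
      have hiff : bits x.1 = 0 ↔ bits y.1 = 0 := by
        constructor
        · intro hx; exact of_decide_eq_true ((decide_eq_true hx).symm.trans hxy ▸ rfl)
        · intro hy; exact of_decide_eq_true ((decide_eq_true hy).symm.trans hxy.symm ▸ rfl)
      rcases hval x.1 x.2.1 x.2.2.1 x.2.2.2 with hx | hx <;> rcases hval y.1 y.2.1 y.2.2.1 y.2.2.2 with hy | hy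
      · rw [hx, hy]
      · rw [hx, hiff.mp hx]
      · rw [hiff.mpr hy, hy]
      · rw [hx, hy]
    apply Subtype.ext
    rw [← sub_eq_zero]
    refine hinj _ (sub_mem x.2.1 y.2.1) ?_ ?_ ?_
    · rw [map_sub, map_sub, map_sub, x.2.2.1, y.2.2.1, sub_zero]
    · rw [map_sub, map_sub, map_sub, x.2.2.2, y.2.2.2, sub_zero]
    · rw [bits_sub, hbits, sub_self]
  haveI : Finite {c : galH1Torsion (E.quadraticTwist d) 2 // c ∈ selmerGroup (E.quadraticTwist d) 2 ∧
      parityHom p (kummerEquiv ℚ 2 ((E.quadraticTwist d).twoTorsionCharH1 h' c)) = 0 ∧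
      parityHom p (kummerEquiv ℚ 2 ((E.quadraticTwist d).twoTorsionCharH1 h'.swap₁₂ c)) = 0} := Finite.of_injective g hg
  have hle := Nat.card_le_card_of_injective g hg
  rw [Nat.card_eq_fintype_card (α := Bool), Fintype.card_bool] at hle
  haveI : Nonempty {c : galH1Torsion (E.quadraticTwist d) 2 // c ∈ selmerGroup (E.quadraticTwist d) 2 ∧
      parityHom p (kummerEquiv ℚ 2 ((E.quadraticTwist d).twoTorsionCharH1 h' c)) = 0 ∧
      parityHom p (kummerEquiv ℚ 2 ((E.quadraticTwist d).twoTorsionCharH1 h'.swap₁₂ c)) = 0} :=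
    ⟨⟨0, zero_mem _, by rw [_root_.map_zero, _root_.map_zero, _root_.map_zero],
      by rw [_root_.map_zero, _root_.map_zero, _root_.map_zero]⟩⟩
  have hpos := Nat.card_pos (α := {c : galH1Torsion (E.quadraticTwist d) 2 // c ∈ selmerGroup (E.quadraticTwist d) 2 ∧
      parityHom p (kummerEquiv ℚ 2 ((E.quadraticTwist d).twoTorsionCharH1 h' c)) = 0 ∧
      parityHom p (kummerEquiv ℚ 2 ((E.quadraticTwist d).twoTorsionCharH1 h'.swap₁₂ c)) = 0})
  omega

end Count

end Summit.BirchSwinnertonDyer.BirchSwinnertonDyer.Theorems.GenusKolyvaginAtTwo.TorsionCellD0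

end
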